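import Summits.AnomalousDissipation.AnomalousDissipation.Theorems.ImpulseGridGridInjectionIdentity
import Literature.Analysis.FluidPDE.TimeAverageMeasureExistence

/-!
# Route ImpulseGrid (AnomalousDissipation) — crux `GridThesis`, line `Sketch`: stub W5,
DC work from DC eddy drag

Supports item `stmt-AnomalousDissipation-1770`
(`Summit.AnomalousDissipation.AnomalousDissipation.Theses.ImpulseGrid.GridThesis`), clause (a)
"no reversal" `Λ⟨(G,u)⟩ ≥ 0`. Given the exact modal balance (the α-balance, stub W3 of the line,
taken here as the first hypothesis)
`(f,G)·Λ⟨a⟩ = νλ·Λ⟨a²⟩ − Λ⟨a·T_G(u)⟩` with `a(t) = (G,u(t))`, `T_G(u)(t) = ∫⟪u(t),(u(t)·∇)G⟫`,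
for a steady smooth force `f`, a smooth divergence-free Stokes eigenfield `G` (`ΔG = −λG`) with
`νλ ≥ 0` and `(f,G) > 0`, and a global Leray–Hopf solution with sup-bounded kinetic energy:
DC eddy drag `Λ⟨a·T_G(u)⟩ ≤ 0` forces `Λ⟨a⟩ ≥ 0`.

Proof: `Λ⟨a²⟩ ≥ 0` by positivity of generalized long-time averages on nonnegative functions
bounded on `(0, ∞)` (`GeneralizedLimit.longTimeAvg_nonneg`, FMRT 2001 Ch. IV (1.35)); the bound
`|a(t)| ≤ K(1+2C)/2` for `t ≥ 0` (`K = sup ‖G‖`, `C = sup_{t ≥ 0} ½‖u(t)‖₂²`) is the route's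
`impulseGrid_abs_integral_inner_le` (file `ImpulseGridMeanMomentumBalance`). Hence the right side
of the balance is `≥ 0`, so `(f,G)·Λ⟨a⟩ ≥ 0`, and `(f,G) > 0` gives `Λ⟨a⟩ ≥ 0`.

No new definitions.

References: Foias–Manley–Rosa–Temam 2001, Ch. IV §1.3 (1.35), §3.1; Doering–Foias 2002 §2.
-/

noncomputable section

-- `Summit.<Summit>.<Problem>` is the tree's mandated summit-side namespace (CONVENTIONS §2); for this
-- single-conjunct summit the two coincide, so the duplicate is deliberate.
set_option linter.dupNamespace false

open MeasureTheory Set Filter Topology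
open scoped InnerProductSpace RealInnerProductSpace

namespace Summit.AnomalousDissipation.AnomalousDissipation.Theorems

open Literature.Analysis.FluidPDE Literature.Analysis.FluidPDE.Torus
open Literature.Analysis.FunctionSpaces Literature.Analysis.FunctionSpaces.Torus

/-- **The mean squared amplitude is nonnegative.** For a global Leray–Hopf solution `u` under a
steady force with `sup_{t ≥ 0} ½‖u(t)‖₂²` finite and a continuous field `G`, the generalized
long-time average of `a(t)² = (G,u(t))²` is `≥ 0`: `a²` is nonnegative and bounded on `(0, ∞)`
(`|a(t)| ≤ K(1+2C)/2`, `impulseGrid_abs_integral_inner_le`), and `Λ⟨·⟩` is positive on such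
functions (`GeneralizedLimit.longTimeAvg_nonneg`, FMRT 2001 Ch. IV (1.35)). [folklore] -/
theorem impulseGrid_longTimeAvg_sq_integral_inner_nonneg (Λ : GeneralizedLimit) {ν : ℝ}
    {f G u₀ : UnitAddTorus (Fin 3) → EuclideanSpace ℝ (Fin 3)}
    {u : ℝ → UnitAddTorus (Fin 3) → EuclideanSpace ℝ (Fin 3)} (hG : Continuous G)
    (hu : IsGlobalLerayHopf ν (fun _ => f) u₀ u)
    (hE : ∃ C : ℝ, ∀ t : ℝ, 0 ≤ t → kineticEnergy (u t) ≤ C) :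
    0 ≤ Λ.longTimeAvg (fun t => (∫ x, ⟪G x, u t x⟫) ^ 2) := by
  obtain ⟨C, hC⟩ := hE
  obtain ⟨K, hK0, hK⟩ := exists_nonneg_forall_norm_le_of_continuous hG
  refine Λ.longTimeAvg_nonneg (fun t => sq_nonneg _) (C := (K * (2⁻¹ * (1 + 2 * C))) ^ 2) ?_
  intro t ht
  have hflip : ∫ x, ⟪G x, u t x⟫ = ∫ x, ⟪u t x, G x⟫ :=
    integral_congr_ae (ae_of_all _ fun x => real_inner_comm _ _)
  have h1 : |∫ x, ⟪u t x, G x⟫| ≤ K * (2⁻¹ * (1 + 2 * C)) :=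
    impulseGrid_abs_integral_inner_le hu hK0 hK hC ht.le
  rw [abs_pow, hflip]
  exact pow_le_pow_left₀ (abs_nonneg _) h1 2

/-- **Stub W5 of crux `GridThesis` (item stmt-AnomalousDissipation-1770), line `Sketch`: DC work
from DC eddy drag.** Given the α-balance (first hypothesis)
`(f,G)·Λ⟨a⟩ = νλ·Λ⟨a²⟩ − Λ⟨a·T_G(u)⟩` (`a = (G,u)`): for a smooth divergence-free Stokes
eigenfield `G` with `νλ ≥ 0` and `(f,G) > 0`, DC eddy drag `Λ⟨a·T_G(u)⟩ ≤ 0` forces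
`Λ⟨a⟩ ≥ 0`, since `Λ⟨a²⟩ ≥ 0` (`impulseGrid_longTimeAvg_sq_integral_inner_nonneg`) makes the
right side of the balance nonnegative. [folklore] -/
theorem stub_dcWorkOfDrag :
    ∀ (Λ : GeneralizedLimit) (ν lam : ℝ) (f G u₀ : UnitAddTorus (Fin 3) → EuclideanSpace ℝ (Fin 3))
      (u : ℝ → UnitAddTorus (Fin 3) → EuclideanSpace ℝ (Fin 3)),
      (∀ (Λ : GeneralizedLimit) (ν lam : ℝ)
        (f G u₀ : UnitAddTorus (Fin 3) → EuclideanSpace ℝ (Fin 3))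
        (u : ℝ → UnitAddTorus (Fin 3) → EuclideanSpace ℝ (Fin 3)),
        IsSmooth f → IsSmooth G → IsDivFree G →
        (∀ x, laplacian G x = -(lam • G x)) →
        IsGlobalLerayHopf ν (fun _ => f) u₀ u →
        (∃ C : ℝ, ∀ t : ℝ, 0 ≤ t → kineticEnergy (u t) ≤ C) →
        (∫ x, ⟪f x, G x⟫) * Λ.longTimeAvg (fun t => ∫ x, ⟪G x, u t x⟫) =
          ν * lam * Λ.longTimeAvg (fun t => (∫ x, ⟪G x, u t x⟫) ^ 2) -
            Λ.longTimeAvg (fun t => (∫ x, ⟪G x, u t x⟫) * ∫ x, ⟪u t x, convect (u t) G x⟫)) →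
      IsSmooth f → IsSmooth G → IsDivFree G →
      (∀ x, laplacian G x = -(lam • G x)) → 0 ≤ ν * lam → (0 < ∫ x, ⟪f x, G x⟫) →
      IsGlobalLerayHopf ν (fun _ => f) u₀ u →
      (∃ C : ℝ, ∀ t : ℝ, 0 ≤ t → kineticEnergy (u t) ≤ C) →
      Λ.longTimeAvg (fun t => (∫ x, ⟪G x, u t x⟫) * ∫ x, ⟪u t x, convect (u t) G x⟫) ≤ 0 →
      0 ≤ Λ.longTimeAvg (fun t => ∫ x, ⟪G x, u t x⟫) := by
  intro Λ ν lam f G u₀ u hbal hf hG hdiv hlap hνlam hfG hu hE hdrag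
  -- the α-balance at `(Λ, ν, lam, f, G, u₀, u)`
  have hb := hbal Λ ν lam f G u₀ u hf hG hdiv hlap hu hE
  -- `Λ⟨a²⟩ ≥ 0`
  have hsq : 0 ≤ Λ.longTimeAvg (fun t => (∫ x, ⟪G x, u t x⟫) ^ 2) :=
    impulseGrid_longTimeAvg_sq_integral_inner_nonneg Λ hG.continuous hu hE
  -- the right side of the balance is nonnegative
  have hprod : 0 ≤ (∫ x, ⟪f x, G x⟫) * Λ.longTimeAvg (fun t => ∫ x, ⟪G x, u t x⟫) := by
    rw [hb]
    have h := mul_nonneg hνlam hsq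
    linarith
  exact nonneg_of_mul_nonneg_right hprod hfG

end Summit.AnomalousDissipation.AnomalousDissipation.Theorems

end
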